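import Literature.InformationTheory.QuantumCodes.RotatedSurfaceCodeDrawingZ
import Literature.InformationTheory.QuantumCodes.RotatedSurfaceCodeDrawing
import HarnessLib

/-!
# The rotated surface code under INHOMOGENEOUS space-time noise (every qubit fault and every measurement fault independent with
# its own rate `≤ ρ`): `Prob[odd projected residual] ≤ L·T·C·r^L/(1-r)`, `r = 2ν√(ρ(1-ρ))`, both sectors, and `→ 0` for
# polynomially many rounds when `4ν² ρ(1-ρ) < 1`

Topic `Literature/InformationTheory/QuantumCodes` (venture QEC, LADDER-QEC rung Q5, PARTITION row 09 "phenomenological";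
qec-type-09 gen 7, line D50.L6 «L-PHENOM» / item «09.RSCPH», inhomogeneous form). All PROVED, kernel axioms, no named fact.
The generic counting bound `CheckDrawing.sum_indepWeight_oddResidual_le` (location-dependent rates, DKLP eq. (28) with `p̃` at
the largest rate) applied to the space-time lifts `(rscDrawing L).spaceTime T` / `(rscDrawingZ L).spaceTime T`
(`RotatedSurfaceCodeDrawing(Z).lean`, `DrawnCheckMatrixSpaceTime.lean`): the two-rate model `(p, q)` of
Dennis–Kitaev–Landahl–Preskill §4.2 is the special case `r = phenomRate p q`; here the rate may depend on the qubit, the check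
and the round (drifting / non-uniform hardware), as long as every rate is `≤ ρ`.

* `CheckDrawing.tendsto_of_le_linear_polyRounds_geometric` — the real-analysis step used by every space-time threshold of the row:
  `0 ≤ a(i) ≤ (i+1)·T(i)·K·r^{i+1}` with `T` polynomially bounded and `0 ≤ r < 1` forces `a(i) → 0`;
* ★ `rsc_st_sum_indepWeight_oddResidual_le` / `rsc_stZ_sum_indepWeight_oddResidual_le` — `H_X` / `H_Z` sector, `L ≥ 1`, rates
  `0 ≤ r_ℓ ≤ ρ ≤ 1/2` on the fault locations, minimum-weight space-time decoder, `cₙ(ℤ³) ≤ C νⁿ`, `r = 2ν√(ρ(1-ρ)) < 1`: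
  `Σ_{E : odd column-0 (row-0) projected residual} w_r(E) ≤ L·T·C·r^L/(1-r)`;
* `rsc_st_tendsto_sum_indepWeight_oddResidual` / `rsc_stZ_…` — along `L = i + 1`, for polynomially many rounds and any rate
  functions `r i` with `0 ≤ r i ℓ ≤ ρ`, `4ν² ρ(1-ρ) < 1`, these sums tend to `0`.

## References

* [DennisEtAl2002] E. Dennis, A. Kitaev, A. Landahl, J. Preskill, *Topological quantum memory*, J. Math. Phys. 43 (2002)
  4452–4505, arXiv:quant-ph/0110143, §4.2 (independent faults on horizontal and vertical links), §5.2 eq. (28), §5.3 eqs.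
  (saw_3), (threshold_iso), (fail_iso) ("with T increasing no faster than a polynomial of L").
-/

namespace Literature.InformationTheory.QuantumCodes

namespace CheckDrawing

open Filter Topology

/-! ### The analysis step: linear × polynomial × geometric tends to zero -/

/-- **`(i+1)·T(i)·K·r^{i+1} → 0` squeezes**: if `0 ≤ a(i) ≤ (i+1)·T(i)·K·r^{i+1}` for a polynomially bounded schedule `T`,
`0 ≤ K` and `0 ≤ r < 1`, then `a(i) → 0`. [cite: DennisEtAl2002, §5.3 (after eq. (fail_iso): "with T increasing no faster than a polynomial of L")] -/
theorem tendsto_of_le_linear_polyRounds_geometric {Tk : ℕ → ℕ} (hT : ToricCode.IsPolyBounded Tk) {K r : ℝ} (hK : 0 ≤ K)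
    (hr0 : 0 ≤ r) (hr1 : r < 1) {a : ℕ → ℝ} (ha0 : ∀ i, 0 ≤ a i)
    (ha : ∀ i, a i ≤ ((i + 1 : ℕ) : ℝ) * (Tk i) * K * r ^ (i + 1)) : Tendsto a atTop (𝓝 0) := by
  obtain ⟨A, m, hA⟩ := hT
  have hbound : ∀ i : ℕ, a i ≤ ((i + 1 : ℕ) : ℝ) * (A * ((i : ℝ) + 1) ^ m) * K * r ^ (i + 1) := by
    intro i
    refine (ha i).trans ?_
    have hk : (0 : ℝ) ≤ ((i + 1 : ℕ) : ℝ) := by positivity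
    exact mul_le_mul_of_nonneg_right (mul_le_mul_of_nonneg_right (mul_le_mul_of_nonneg_left (hA i) hk) hK)
      (pow_nonneg hr0 _)
  have hlim : Tendsto (fun i : ℕ => ((i + 1 : ℕ) : ℝ) * (A * ((i : ℝ) + 1) ^ m) * K * r ^ (i + 1)) atTop (𝓝 0) := by
    have h0 := tendsto_pow_const_mul_const_pow_of_abs_lt_one (m + 1) (show |r| < 1 by rwa [abs_of_nonneg hr0])
    have h1 : Tendsto (fun i : ℕ => ((i + 1 : ℕ) : ℝ) ^ (m + 1) * r ^ (i + 1)) atTop (𝓝 0) :=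
      (Filter.tendsto_add_atTop_iff_nat 1).2 h0
    have h2 := h1.const_mul (A * K)
    rw [mul_zero] at h2
    refine h2.congr fun i => ?_
    push_cast
    ring
  exact squeeze_zero ha0 hbound hlim

end CheckDrawing

namespace RotatedSurface

open Finset Matrix Filter Topology CSSPhenom
open Literature.Probability.LatticeModels (Site)
open Literature.Probability.RandomPlanarGeometry

variable {L : ℕ}

/-! ### `H_X` sector -/

open Classical in
/-- ★ **Inhomogeneous space-time counting bound, `H_X` sector of `RSC(L)`** (`L ≥ 1`, `T` rounds): for independent faults with
location-dependent rates `0 ≤ r_ℓ ≤ ρ ≤ 1/2` (qubit faults and measurement faults alike), a minimum-weight space-time decoder `D`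
and `cₙ(ℤ³) ≤ C νⁿ` with `r = 2ν√(ρ(1-ρ)) < 1`, the total probability of the histories whose residual projects to a chain with an
odd number of column-`0` qubits is `≤ L·T·C·r^L/(1-r)`. [cite: DennisEtAl2002, §5.2 eq. (28) (p̃ at the largest rate), §5.3 eqs. (saw_3), (fail_iso)] -/
theorem rsc_st_sum_indepWeight_oddResidual_le (hL : 0 < L) {C ν : ℝ} (hν : 0 < ν) (hC : ToricCode.SAWCountBound3 C ν)
    {T : ℕ} {D : STDecoder (Fin (L + 1) × Fin (L - 1)) (Fin L × Fin L) T}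
    (hD : D.IsMinWeight (stSyn (HX L) T) (stCycles (HX L) T) hammingNorm)
    {r : HistoryLoc (Fin L × Fin L) (Fin (L + 1) × Fin (L - 1)) T → ℝ} {ρ : ℝ} (hr0 : ∀ ℓ, 0 ≤ r ℓ)
    (hrρ : ∀ ℓ, r ℓ ≤ ρ) (hρ : ρ ≤ 1 / 2) (hr1 : 2 * ν * Real.sqrt (ρ * (1 - ρ)) < 1) :
    ∑ E ∈ univ.filter (fun E : History (Fin (L + 1) × Fin (L - 1)) (Fin L × Fin L) T =>
        ∑ i : Fin L, proj (D (stSyn (HX L) T E) + E) (i, ⟨0, hL⟩) = 1), indepWeight r (supp E) ≤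
      (L : ℝ) * T * C * (2 * ν * Real.sqrt (ρ * (1 - ρ))) ^ L / (1 - 2 * ν * Real.sqrt (ρ * (1 - ρ))) := by
  classical
  have h := ((rscDrawing L).spaceTime T).sum_indepWeight_oddResidual_le
    ((rscDrawing L).spaceTime_heightGap T (rscDrawing_heightGap hL)) hν hC (D := D) hD hr0 hrρ hρ hr1
  rw [Fintype.card_prod, Fintype.card_fin, Fintype.card_fin, Nat.cast_mul] at h
  refine le_trans (le_of_eq (Finset.sum_congr (Finset.filter_congr fun E _ => ?_) fun _ _ => rfl)) h
  rw [CheckDrawing.sum_mul_bot_spaceTime, sum_mul_rscDrawing_bot hL]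
  exact Iff.rfl

open Classical in
/-- **`H_X` sector, inhomogeneous space-time noise: `→ 0`** along `L = i + 1` for polynomially many rounds, any rate
functions `r i` on the fault locations with `0 ≤ r i ℓ ≤ ρ ≤ 1/2`, every family of minimum-weight space-time decoders,
`cₙ(ℤ³) ≤ C νⁿ`, `4ν² ρ(1-ρ) < 1`. [cite: DennisEtAl2002, §5.3 eqs. (threshold_iso), (fail_iso)] -/
theorem rsc_st_tendsto_sum_indepWeight_oddResidual {C ν : ℝ} (hν : 0 < ν) (hC : ToricCode.SAWCountBound3 C ν)
    {Tk : ℕ → ℕ} (hT : ToricCode.IsPolyBounded Tk)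
    (D : ∀ i : ℕ, STDecoder (Fin (i + 1 + 1) × Fin (i + 1 - 1)) (Fin (i + 1) × Fin (i + 1)) (Tk i))
    (hD : ∀ i, (D i).IsMinWeight (stSyn (HX (i + 1)) (Tk i)) (stCycles (HX (i + 1)) (Tk i)) hammingNorm)
    (r : ∀ i : ℕ, HistoryLoc (Fin (i + 1) × Fin (i + 1)) (Fin (i + 1 + 1) × Fin (i + 1 - 1)) (Tk i) → ℝ) {ρ : ℝ} (hρ0 : 0 ≤ ρ)
    (hr0 : ∀ i ℓ, 0 ≤ r i ℓ) (hrρ : ∀ i ℓ, r i ℓ ≤ ρ) (hρ : ρ ≤ 1 / 2) (h4 : 4 * ν ^ 2 * (ρ * (1 - ρ)) < 1) :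
    Tendsto (fun i => ∑ E ∈ univ.filter (fun E : History (Fin (i + 1 + 1) × Fin (i + 1 - 1)) (Fin (i + 1) × Fin (i + 1))
        (Tk i) => ∑ j : Fin (i + 1), proj (D i (stSyn (HX (i + 1)) (Tk i) E) + E) (j, ⟨0, by omega⟩) = 1),
        indepWeight (r i) (supp E)) atTop (𝓝 0) := by
  set s := Real.sqrt (ρ * (1 - ρ)) with hs
  set r' := 2 * ν * s with hr
  have hs0 : 0 ≤ s := Real.sqrt_nonneg _
  have hr0' : 0 ≤ r' := by rw [hr]; positivity
  have hpp : 0 ≤ ρ * (1 - ρ) := mul_nonneg hρ0 (by linarith)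
  have hr1 : r' < 1 := by
    have hsq : r' ^ 2 = 4 * ν ^ 2 * (ρ * (1 - ρ)) := by
      rw [hr, mul_pow, mul_pow, hs, Real.sq_sqrt hpp]
      ring
    have h : r' ^ 2 < 1 := by rw [hsq]; exact h4
    have := (sq_lt_one_iff_abs_lt_one r').1 h
    rwa [abs_of_nonneg hr0'] at this
  have h1r : 0 < 1 - r' := by linarith
  have hC0 : 0 ≤ C := by
    have h0 := hC 0
    rw [SAW.Zd.count_zero, pow_zero, mul_one, Nat.cast_one] at h0
    linarith
  refine CheckDrawing.tendsto_of_le_linear_polyRounds_geometric hT (K := C / (1 - r')) (by positivity) hr0' hr1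
    (fun i => Finset.sum_nonneg fun E _ => indepWeight_nonneg (hr0 i) (fun ℓ => (hrρ i ℓ).trans (by linarith)) _)
    fun i => ?_
  refine (rsc_st_sum_indepWeight_oddResidual_le (L := i + 1) (by omega) hν hC (hD i) (hr0 i) (hrρ i) hρ hr1).trans
    (le_of_eq ?_)
  rw [hr, hs]
  ring

/-! ### `H_Z` sector -/

open Classical in
/-- ★ **Inhomogeneous space-time counting bound, `H_Z` sector of `RSC(L)`** (`L ≥ 1`, `T` rounds, rates `0 ≤ r_ℓ ≤ ρ ≤ 1/2`,
minimum-weight space-time decoder, `cₙ(ℤ³) ≤ C νⁿ`, `r = 2ν√(ρ(1-ρ)) < 1`): the total probability of the histories whose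
residual projects to a chain with an odd number of row-`0` qubits is `≤ L·T·C·r^L/(1-r)`.
[cite: DennisEtAl2002, §5.2 eq. (28) (p̃ at the largest rate), §5.3 eqs. (saw_3), (fail_iso)] -/
theorem rsc_stZ_sum_indepWeight_oddResidual_le (hL : 0 < L) {C ν : ℝ} (hν : 0 < ν) (hC : ToricCode.SAWCountBound3 C ν)
    {T : ℕ} {D : STDecoder (Fin (L - 1) × Fin (L + 1)) (Fin L × Fin L) T}
    (hD : D.IsMinWeight (stSyn (HZ L) T) (stCycles (HZ L) T) hammingNorm)
    {r : HistoryLoc (Fin L × Fin L) (Fin (L - 1) × Fin (L + 1)) T → ℝ} {ρ : ℝ} (hr0 : ∀ ℓ, 0 ≤ r ℓ)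
    (hrρ : ∀ ℓ, r ℓ ≤ ρ) (hρ : ρ ≤ 1 / 2) (hr1 : 2 * ν * Real.sqrt (ρ * (1 - ρ)) < 1) :
    ∑ E ∈ univ.filter (fun E : History (Fin (L - 1) × Fin (L + 1)) (Fin L × Fin L) T =>
        ∑ j : Fin L, proj (D (stSyn (HZ L) T E) + E) (⟨0, hL⟩, j) = 1), indepWeight r (supp E) ≤
      (L : ℝ) * T * C * (2 * ν * Real.sqrt (ρ * (1 - ρ))) ^ L / (1 - 2 * ν * Real.sqrt (ρ * (1 - ρ))) := by
  classical
  have h := ((rscDrawingZ L).spaceTime T).sum_indepWeight_oddResidual_le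
    ((rscDrawingZ L).spaceTime_heightGap T (rscDrawingZ_heightGap hL)) hν hC (D := D) hD hr0 hrρ hρ hr1
  rw [Fintype.card_prod, Fintype.card_fin, Fintype.card_fin, Nat.cast_mul] at h
  refine le_trans (le_of_eq (Finset.sum_congr (Finset.filter_congr fun E _ => ?_) fun _ _ => rfl)) h
  rw [CheckDrawing.sum_mul_bot_spaceTime, sum_mul_rscDrawingZ_bot hL]
  exact Iff.rfl

open Classical in
/-- **`H_Z` sector, inhomogeneous space-time noise: `→ 0`** along `L = i + 1` for polynomially many rounds, any rate
functions `r i` on the fault locations with `0 ≤ r i ℓ ≤ ρ ≤ 1/2`, every family of minimum-weight space-time decoders,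
`cₙ(ℤ³) ≤ C νⁿ`, `4ν² ρ(1-ρ) < 1`. [cite: DennisEtAl2002, §5.3 eqs. (threshold_iso), (fail_iso)] -/
theorem rsc_stZ_tendsto_sum_indepWeight_oddResidual {C ν : ℝ} (hν : 0 < ν) (hC : ToricCode.SAWCountBound3 C ν)
    {Tk : ℕ → ℕ} (hT : ToricCode.IsPolyBounded Tk)
    (D : ∀ i : ℕ, STDecoder (Fin (i + 1 - 1) × Fin (i + 1 + 1)) (Fin (i + 1) × Fin (i + 1)) (Tk i))
    (hD : ∀ i, (D i).IsMinWeight (stSyn (HZ (i + 1)) (Tk i)) (stCycles (HZ (i + 1)) (Tk i)) hammingNorm)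
    (r : ∀ i : ℕ, HistoryLoc (Fin (i + 1) × Fin (i + 1)) (Fin (i + 1 - 1) × Fin (i + 1 + 1)) (Tk i) → ℝ) {ρ : ℝ} (hρ0 : 0 ≤ ρ)
    (hr0 : ∀ i ℓ, 0 ≤ r i ℓ) (hrρ : ∀ i ℓ, r i ℓ ≤ ρ) (hρ : ρ ≤ 1 / 2) (h4 : 4 * ν ^ 2 * (ρ * (1 - ρ)) < 1) :
    Tendsto (fun i => ∑ E ∈ univ.filter (fun E : History (Fin (i + 1 - 1) × Fin (i + 1 + 1)) (Fin (i + 1) × Fin (i + 1))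
        (Tk i) => ∑ j : Fin (i + 1), proj (D i (stSyn (HZ (i + 1)) (Tk i) E) + E) (⟨0, by omega⟩, j) = 1),
        indepWeight (r i) (supp E)) atTop (𝓝 0) := by
  set s := Real.sqrt (ρ * (1 - ρ)) with hs
  set r' := 2 * ν * s with hr
  have hs0 : 0 ≤ s := Real.sqrt_nonneg _
  have hr0' : 0 ≤ r' := by rw [hr]; positivity
  have hpp : 0 ≤ ρ * (1 - ρ) := mul_nonneg hρ0 (by linarith)
  have hr1 : r' < 1 := by
    have hsq : r' ^ 2 = 4 * ν ^ 2 * (ρ * (1 - ρ)) := by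
      rw [hr, mul_pow, mul_pow, hs, Real.sq_sqrt hpp]
      ring
    have h : r' ^ 2 < 1 := by rw [hsq]; exact h4
    have := (sq_lt_one_iff_abs_lt_one r').1 h
    rwa [abs_of_nonneg hr0'] at this
  have h1r : 0 < 1 - r' := by linarith
  have hC0 : 0 ≤ C := by
    have h0 := hC 0
    rw [SAW.Zd.count_zero, pow_zero, mul_one, Nat.cast_one] at h0
    linarith
  refine CheckDrawing.tendsto_of_le_linear_polyRounds_geometric hT (K := C / (1 - r')) (by positivity) hr0' hr1
    (fun i => Finset.sum_nonneg fun E _ => indepWeight_nonneg (hr0 i) (fun ℓ => (hrρ i ℓ).trans (by linarith)) _)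
    fun i => ?_
  refine (rsc_stZ_sum_indepWeight_oddResidual_le (L := i + 1) (by omega) hν hC (hD i) (hr0 i) (hrρ i) hρ hr1).trans
    (le_of_eq ?_)
  rw [hr, hs]
  ring

end RotatedSurface

end Literature.InformationTheory.QuantumCodes
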